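import Summits.MatrixMultiplication.MatrixMultiplication.Theorems.SoloInformedValVSize

/-!
# The index lemma: blocks whose data live in one coset of a subgroup

Setting of `SoloInformedValFamilyCriterion` (a finite family of complete blocks `X_t × Y_t × Z_t` in an abelian
group, identity potentials).  Let `S` be a finite set closed under subtraction (a finite subgroup) and suppose the
rows of block `t` lie in one coset `α + S`, its difference set `Y_t − Z_t` lies in `c_t + S`, and for another
block `u ≠ t` of the family the difference set `Y_u − Z_u` lies in `c_u + S` with `c_t − c_u ∈ S` (the two blocks
have the SAME INDEX in `G/S`).  Then `M_t = X_t + Y_t − Z_t` and `(X_t ∩ X_u) + (Y_u − Z_u) ⊆ U_t` are disjoint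
subsets of the single coset `α + c_t + S`, and by the additive TPP at `t` and at `u` they have
`|X_t||Y_t||Z_t|` and `|X_t ∩ X_u||Y_u||Z_u|` elements:

  `|X_t||Y_t||Z_t| + |X_t ∩ X_u||Y_u||Z_u| ≤ |S|`      (`FamilyCriterionAt.index_lemma`, `NoAccidental.index_lemma`).

Consequence used on paper (dossier §15.8 (n)(xx ι)): in a pure subspace design whose period spaces all lie in a
proper subspace `Σ` and whose rows lie in one `Σ`-coset, two blocks sharing more than `(|Σ| − v_t)/(y_u z_u)` rows
have distinct indices `c_t ≢ c_u (mod Σ)`; with the shadow lemma this kills the small-slack pure shapes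
(10,5) 126×64×32 in `𝔽_2^19` and (11,6) 252×64×64 in `𝔽_2^21`.
-/

namespace Summit.MatrixMultiplication.MatrixMultiplication.Theorems.SoloVal

open Finset

section IndexLemma

variable {G : Type*} [AddCommGroup G] [DecidableEq G]
variable {ι : Type*} [DecidableEq ι] {T : Finset ι} {X Y Z : ι → Finset G} {t u : ι}

omit [DecidableEq G] [DecidableEq ι] in
/-- The additive TPP is inherited by a smaller row set. -/
theorem AddTPP.subset_left {X₀ X₁ Y₀ Z₀ : Finset G} (h : AddTPP X₀ Y₀ Z₀) (hX : X₁ ⊆ X₀) :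
    AddTPP X₁ Y₀ Z₀ := by
  intro x hx x' hx' y hy y' hy' z hz z' hz' h0
  exact h (hX hx) (hX hx') hy hy' hz hz' h0

/-- `(X_t ∩ X_u) + Y_u − Z_u ⊆ U_t` for a block `u ≠ t` of the family. -/
theorem mixedImage_inter_subset_crossU (hu : u ∈ T) (hut : u ≠ t) :
    mixedImage (X t ∩ X u) (Y u) (Z u) ⊆ crossU T X Y Z t := by
  intro g hg
  obtain ⟨x, hx, y, hy, z, hz, rfl⟩ := mem_mixedImage.mp hg
  exact mem_crossU.mpr ⟨x, (Finset.mem_inter.mp hx).1, u, Finset.mem_erase.mpr ⟨hut, hu⟩, y, hy, z, hz,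
    by abel⟩

omit [DecidableEq G] [DecidableEq ι] in
/-- A set closed under subtraction is closed under addition. -/
theorem subClosed_add_mem {S : Finset G} (hS : ∀ r ∈ S, ∀ s ∈ S, r - s ∈ S) {a b : G} (ha : a ∈ S)
    (hb : b ∈ S) : a + b ∈ S := by
  have h := hS a ha (-b) (subClosed_neg_mem hS hb)
  rwa [sub_neg_eq_add] at h

omit [DecidableEq ι] in
/-- If `X₀ ⊆ α + S` and `Y₀ − Z₀ ⊆ c + S` then `X₀ + Y₀ − Z₀ ⊆ (α + c) + S`. -/
theorem mixedImage_subset_coset {X₀ Y₀ Z₀ S : Finset G} (hS : ∀ r ∈ S, ∀ s ∈ S, r - s ∈ S) {α c : G}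
    (hX : ∀ x ∈ X₀, x - α ∈ S) (hD : ∀ y ∈ Y₀, ∀ z ∈ Z₀, y - z - c ∈ S) :
    mixedImage X₀ Y₀ Z₀ ⊆ S.image fun s => (α + c) + s := by
  intro g hg
  obtain ⟨x, hx, y, hy, z, hz, rfl⟩ := mem_mixedImage.mp hg
  refine Finset.mem_image.mpr ⟨(x - α) + (y - z - c), subClosed_add_mem hS (hX x hx) (hD y hy z hz), ?_⟩
  abel

/-- THE INDEX LEMMA.  Under the family criterion at `t` and the additive TPP at `u ≠ t`: if the rows of `X_t` lie
in `α + S`, `Y_t − Z_t ⊆ c_t + S`, `Y_u − Z_u ⊆ c_u + S` and `c_t − c_u ∈ S` for a subtraction-closed `S`, then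
`|X_t||Y_t||Z_t| + |X_t ∩ X_u||Y_u||Z_u| ≤ |S|`. -/
theorem FamilyCriterionAt.index_lemma (h : FamilyCriterionAt T X Y Z t) (hTu : AddTPP (X u) (Y u) (Z u))
    {S : Finset G} (hS : ∀ r ∈ S, ∀ s ∈ S, r - s ∈ S) {α ct cu : G}
    (hX : ∀ x ∈ X t, x - α ∈ S) (hDt : ∀ y ∈ Y t, ∀ z ∈ Z t, y - z - ct ∈ S)
    (hDu : ∀ y ∈ Y u, ∀ z ∈ Z u, y - z - cu ∈ S) (hc : ct - cu ∈ S) (hu : u ∈ T) (hut : u ≠ t) :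
    (X t).card * (Y t).card * (Z t).card + (X t ∩ X u).card * (Y u).card * (Z u).card ≤ S.card := by
  obtain ⟨hT, hMU, -, -⟩ := h
  have hdisj : Disjoint (mixedImage (X t) (Y t) (Z t)) (mixedImage (X t ∩ X u) (Y u) (Z u)) :=
    hMU.mono_right (mixedImage_inter_subset_crossU hu hut)
  have hM : mixedImage (X t) (Y t) (Z t) ⊆ S.image fun s => (α + ct) + s :=
    mixedImage_subset_coset hS hX hDt
  have hDu' : ∀ y ∈ Y u, ∀ z ∈ Z u, y - z - ct ∈ S := by
    intro y hy z hz
    have h1 := hS _ (hDu y hy z hz) _ hc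
    have h2 : y - z - cu - (ct - cu) = y - z - ct := by abel
    rwa [h2] at h1
  have hP : mixedImage (X t ∩ X u) (Y u) (Z u) ⊆ S.image fun s => (α + ct) + s :=
    mixedImage_subset_coset hS (fun x hx => hX x (Finset.mem_inter.mp hx).1) hDu'
  have hcardP : (mixedImage (X t ∩ X u) (Y u) (Z u)).card = (X t ∩ X u).card * (Y u).card * (Z u).card :=
    (AddTPP.subset_left hTu Finset.inter_subset_right).card_mixedImage
  calc (X t).card * (Y t).card * (Z t).card + (X t ∩ X u).card * (Y u).card * (Z u).card
      = (mixedImage (X t) (Y t) (Z t) ∪ mixedImage (X t ∩ X u) (Y u) (Z u)).card := by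
        rw [Finset.card_union_of_disjoint hdisj, hT.card_mixedImage, hcardP]
    _ ≤ (S.image fun s => (α + ct) + s).card := Finset.card_le_card (Finset.union_subset hM hP)
    _ ≤ S.card := Finset.card_image_le

/-- The index lemma for an accidental-free family with pairwise disjoint `Y`- and `Z`-classes. -/
theorem NoAccidental.index_lemma
    (hY : ∀ a ∈ T, ∀ b ∈ T, a ≠ b → Disjoint (Y a) (Y b))
    (hZ : ∀ a ∈ T, ∀ b ∈ T, a ≠ b → Disjoint (Z a) (Z b))
    (hN : NoAccidental (id : G → G) id id (famPairs T X Y) (famPairs T Y Z) (famPairs T Z X))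
    {S : Finset G} (hS : ∀ r ∈ S, ∀ s ∈ S, r - s ∈ S) {α ct cu : G}
    (hX : ∀ x ∈ X t, x - α ∈ S) (hDt : ∀ y ∈ Y t, ∀ z ∈ Z t, y - z - ct ∈ S)
    (hDu : ∀ y ∈ Y u, ∀ z ∈ Z u, y - z - cu ∈ S) (hc : ct - cu ∈ S)
    (ht : t ∈ T) (hu : u ∈ T) (hut : u ≠ t) :
    (X t).card * (Y t).card * (Z t).card + (X t ∩ X u).card * (Y u).card * (Z u).card ≤ S.card :=
  (familyCriterion_of_noAccidental hY hZ hN ht).index_lemma (familyCriterion_of_noAccidental hY hZ hN hu).1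
    hS hX hDt hDu hc hu hut

/-- DISTINCT INDICES.  In the situation of the index lemma, if `|S| < |X_t||Y_t||Z_t| + |X_t ∩ X_u||Y_u||Z_u|`
then the two blocks have different indices: `c_t − c_u ∉ S`. -/
theorem FamilyCriterionAt.index_ne (h : FamilyCriterionAt T X Y Z t) (hTu : AddTPP (X u) (Y u) (Z u))
    {S : Finset G} (hS : ∀ r ∈ S, ∀ s ∈ S, r - s ∈ S) {α ct cu : G}
    (hX : ∀ x ∈ X t, x - α ∈ S) (hDt : ∀ y ∈ Y t, ∀ z ∈ Z t, y - z - ct ∈ S)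
    (hDu : ∀ y ∈ Y u, ∀ z ∈ Z u, y - z - cu ∈ S) (hu : u ∈ T) (hut : u ≠ t)
    (hbig : S.card < (X t).card * (Y t).card * (Z t).card + (X t ∩ X u).card * (Y u).card * (Z u).card) :
    ct - cu ∉ S :=
  fun hc => absurd (h.index_lemma hTu hS hX hDt hDu hc hu hut) (not_le.mpr hbig)

end IndexLemma

end Summit.MatrixMultiplication.MatrixMultiplication.Theorems.SoloVal
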